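import Literature.Analysis.FluidPDE.PassiveScalarForcedEnergyKinetic

/-!
# Regular-condensate theorem, stub RC-K: the kinetic half of the sourced energy inequality

Stub `stub_rcKineticEnergyIneq` of the regular-condensate theorem (crux `TwohalfdNeg`, line
`log-kantorovich-enstrophy-transfer`): for `κ > 0`, an `L²` datum `θ₀`, a smooth steady source
`h` and a weak solution `θ ∈ L^∞(0,T; L²)` of `∂ₜθ + u·∇θ = κΔθ + h` on `T² × [0,T)`
(`Torus.IsWeakScalarTransportForcedOn`) over a drift with `∫₀ᵀ ‖∇u(t)‖_{L²} dt < ∞`,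

  `‖θ(t)‖²_{L²} ≤ ‖θ₀‖²_{L²} + 2 ∫₀ᵗ ∫ θ h`   for a.e. `t ∈ (0,T)`.

This is the `d = 2` case of the tree's
`Torus.IsWeakScalarTransportForcedOn.ae_integral_sq_le_of_lintegral_eGradNormSq_rpow_lt_top`
(`Literature/Analysis/FluidPDE/PassiveScalarForcedEnergyKinetic`), the KINETIC half of the
DiPerna–Lions renormalised energy inequality whose DISSIPATION half is
`Torus.IsWeakScalarTransportForcedOn.energy_ineq_of_lintegral_eGradNormSq_rpow_lt_top`
(`PassiveScalarForcedEnergy`): mollify `Aₙ = θ ⋆ kₙ`, renormalise with `β_M = renorm M`,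
drop the signed renormalised dissipation, let the commutator go (`rₙ → 0` in `L¹_{t,x}`), keep
the kinetic term (`Aₙ(t) → θ(t)` in `L²` at a.e. `t`, `β_M` Lipschitz) and remove the
renormalisation (`M → ∞`, dominated convergence).

## References

* R. J. DiPerna, P.-L. Lions, *Ordinary differential equations, transport theory and Sobolev
  spaces*, Invent. Math. 98 (1989), 511–547, §II.3, Thm. II.3.
* T. D. Drivas, T. M. Elgindi, G. Iyer, I.-J. Jeong, *Anomalous dissipation in passive scalar
  transport*, Arch. Ration. Mech. Anal. 243 (2022), 1151–1180, (1.1)–(1.3).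
-/

namespace Summit.AnomalousDissipation.AnomalousDissipation.Theorems.TwohalfdNeg.RegularCondensate

open MeasureTheory Filter Topology
open scoped ENNReal NNReal InnerProductSpace
open Literature.Analysis.FunctionSpaces Literature.Analysis.FluidPDE

set_option linter.dupNamespace false

/-- **RC-K `stub_rcKineticEnergyIneq` — the kinetic half of the sourced energy inequality.** For
`κ > 0`, an `L²` datum, a smooth steady source and a weak solution on `[0, T)` of
`∂ₜθ + u·∇θ = κΔθ + h` on the two-torus over a drift with `∫₀ᵀ ‖∇u‖_{L²} < ∞`:
`‖θ(t)‖² ≤ ‖θ₀‖² + 2∫₀ᵗ∫ θ h` for a.e. `t ∈ (0, T)` — the case `d = Fin 2` of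
`Torus.IsWeakScalarTransportForcedOn.ae_integral_sq_le_of_lintegral_eGradNormSq_rpow_lt_top`
(DiPerna–Lions renormalisation; the hypothesis `0 < T` is not needed).
[cite: DiPernaLions1989, §II.3 Thm. II.3] -/
theorem stub_rcKineticEnergyIneq :
    ∀ (κ T : ℝ) (u : ℝ → UnitAddTorus (Fin 2) → EuclideanSpace ℝ (Fin 2))
      (h θ₀ : UnitAddTorus (Fin 2) → ℝ) (θ : ℝ → UnitAddTorus (Fin 2) → ℝ),
      0 < κ → 0 < T → Torus.IsSmooth h → MemLp θ₀ 2 volume →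
      Torus.IsWeakScalarTransportForcedOn T κ u (fun _ => h) θ₀ θ →
      (∫⁻ t in Set.Ioo 0 T, Torus.eGradNormSq (u t) ^ (1 / 2 : ℝ) < ⊤) →
      ∀ᵐ t ∂(volume.restrict (Set.Ioo 0 T)),
        ∫ x, θ t x ^ 2 ≤ (∫ x, θ₀ x ^ 2) + 2 * ∫ τ in Set.Ioc 0 t, ∫ x, θ τ x * h x := by
  intro κ T u h θ₀ θ hκ _hT hh hθ₀ hsol hG
  exact hsol.ae_integral_sq_le_of_lintegral_eGradNormSq_rpow_lt_top hκ hθ₀ hh hG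

end Summit.AnomalousDissipation.AnomalousDissipation.Theorems.TwohalfdNeg.RegularCondensate
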